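import Literature.Probability.LatticeModels.CriticalTwoPointAxisLimsup
import HarnessLib

/-!
# The critical two-point function of `ℤ³` on whole balls, and the block second moment, are not
# `o(n^{-3/2})` / `o(L^{9/2})` (ball and block forms of Duminil-Copin–Panis 2025, Theorem 1.3)

Topic `Literature/Probability/LatticeModels`; family `crit-ising`. Theorem-only file (no definition, no
named fact), proved from tree theorems; the "one more MMS comparison" deliberately left out of
`CriticalTwoPointAxisLimsup.lean`.

Duminil-Copin–Panis (CMP 406 (2025), arXiv:2404.05700), Theorem 1.3 at `β = β_c(3)` gives, in the
lossless subsequence form recorded in the tree as `twoPointFree_criticalBeta_axis_frequently_ge`,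
`∃ a > 0`, `a ≤ n^{3/2}⟨σ₀σ_{ne₁}⟩_{β_c}` for infinitely many `n`. The Messager–Miracle-Solé comparisons
(Duminil-Copin 2019, eq. (4.10): `⟨σ₀σ_{dme₁}⟩ ≤ ⟨σ₀σ_y⟩` for `‖y‖_∞ = m`, tree theorem
`twoPointFree_diagAxis_le_of_mem_sphere'`, and axial monotonicity `twoPointFree_add_single_le`) transport
the axial value to the WHOLE ball `{‖y‖_∞ ≤ n/3}`:

* `twoPointFree_axis_le_of_mul_supNorm_le` — `⟨σ₀σ_{ne₁}⟩^f_β ≤ ⟨σ₀σ_y⟩^f_β` whenever `d·‖y‖_∞ ≤ n`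
  (any `d ≥ 1`, `β ≥ 0`);
* `twoPointFree_criticalBeta_ball_frequently_ge` / `criticalTwoPoint_ball_frequently_ge` — `∃ a > 0`,
  for infinitely many `n`: `a ≤ n^{3/2}⟨σ₀σ_y⟩_{β_c(3)}` for ALL `y` with `3‖y‖_∞ ≤ n`;
* `criticalTwoPoint_boxPairSum_frequently_ge` — the block second moment
  `Σ_L := Σ_{x,y ∈ Λ_L}⟨σ_xσ_y⟩_{β_c(3)}` satisfies `a·L^{9/2} ≤ Σ_L` for infinitely many `L`
  ("`η ≤ 1/2` along a subsequence" in block form: the critical block susceptibility `Σ_L/|Λ_L|` is not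
  `o(L^{3/2})`). This is the unconditional floor on `Σ_L` that the block-spin (Lee–Yang, Binder-cumulant)
  routes of `Ising3DConformalLimit` use as yardstick (`…Theses.LeeYangGap.NearCriticalLeeYangGap`,
  `…Theses.PerfectScreening.CoulombImpliesNontrivial`, where the two-sided `L⁵` law is only available
  under the Coulomb hypothesis).

Nothing here is stronger than Theorem 1.3; the upper critical two-point bound is not used.

## References

* H. Duminil-Copin, R. Panis, *New lower bounds for the (near) critical Ising and φ⁴ models' two-point
  functions*, Comm. Math. Phys. 406 (2025), arXiv:2404.05700, Theorem 1.3 and the proof of Theorem 1.5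
  (pp. 5–6 of the arXiv version, held) [DuminilCopinPanis2025LowerBounds].
* H. Duminil-Copin, *Lectures on the Ising and Potts models on the hypercubic lattice* (2019), §4.3,
  Exercise 37 (4), eq. (4.10) [DuminilCopin2019].
* A. Messager, S. Miracle-Solé, J. Stat. Phys. 17 (1977) [MessagerMiracleSoleJSP1977].
-/

noncomputable section

open Filter Finset
open _root_.Topology

namespace Literature.Probability.LatticeModels

/-- **Messager–Miracle-Solé, ball form**: for `d ≥ 1`, `β ≥ 0` and every `y ∈ ℤ^d` with
`d·‖y‖_∞ ≤ n`, `⟨σ₀σ_{ne₁}⟩^f_β ≤ ⟨σ₀σ_y⟩^f_β` (right half of Duminil-Copin 2019, eq. (4.10),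
`⟨σ₀σ_{d‖y‖_∞e₁}⟩ ≤ ⟨σ₀σ_y⟩`, followed by axial monotonicity from `d‖y‖_∞` out to `n`). [cite: DuminilCopin2019, Exercise 37 (4), eq. (4.10), §4.3] [cite: MessagerMiracleSoleJSP1977, main theorem (monotonicity of ⟨σ₀σ_x⟩ under reflections)] -/
theorem twoPointFree_axis_le_of_mul_supNorm_le {d : ℕ} {β : ℝ} (hβ : 0 ≤ β) (hd : 1 ≤ d)
    {n : ℕ} {y : Site d} (hy : d * Site.supNorm y ≤ n) :
    twoPointFree d β (Pi.single (⟨0, hd⟩ : Fin d) (n : ℤ)) ≤ twoPointFree d β y := by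
  have hsph : y ∈ sphere d (Site.supNorm y) := mem_sphere.2 rfl
  have h1 := twoPointFree_diagAxis_le_of_mem_sphere' hβ hd hsph
  have h2 := twoPointFree_add_single_le hβ
    (Pi.single (⟨0, hd⟩ : Fin d) ((d : ℤ) * (Site.supNorm y : ℕ)) : Site d) ⟨0, hd⟩
    (by rw [Pi.single_eq_same]; positivity) (n - d * Site.supNorm y)
  have heq : (Pi.single (⟨0, hd⟩ : Fin d) ((d : ℤ) * (Site.supNorm y : ℕ)) : Site d) +
      Pi.single (⟨0, hd⟩ : Fin d) (((n - d * Site.supNorm y : ℕ) : ℤ)) =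
        (Pi.single (⟨0, hd⟩ : Fin d) (n : ℤ) : Site d) := by
    rw [← Pi.single_add]
    congr 1
    push_cast [Nat.cast_sub hy]
    ring
  rw [heq] at h2
  exact h2.trans h1

/-- **The critical two-point function of `ℤ³` is not `o(n^{-3/2})` uniformly on balls (free state).**
There is `a > 0` such that for infinitely many `n`, `a ≤ n^{3/2}⟨σ₀σ_y⟩^f_{β_c(3)}` for EVERY `y` with
`3‖y‖_∞ ≤ n` — Duminil-Copin–Panis 2025, Theorem 1.3 in subsequence form
(`twoPointFree_criticalBeta_axis_frequently_ge`) transported off the axis by Messager–Miracle-Solé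
(`twoPointFree_axis_le_of_mul_supNorm_le`). [cite: DuminilCopinPanis2025LowerBounds, Theorem 1.3 with the proof of Theorem 1.5 (arXiv:2404.05700 pp. 5–6)] [cite: DuminilCopin2019, eq. (4.10), §4.3] -/
theorem twoPointFree_criticalBeta_ball_frequently_ge :
    ∃ a : ℝ, 0 < a ∧ ∃ᶠ n : ℕ in atTop, ∀ y : Site 3, 3 * Site.supNorm y ≤ n →
      a ≤ (n : ℝ) ^ (3 / 2 : ℝ) * twoPointFree 3 (criticalBeta 3) y := by
  obtain ⟨a, ha, h⟩ := twoPointFree_criticalBeta_axis_frequently_ge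
  refine ⟨a, ha, h.mono fun n hn y hy => hn.trans ?_⟩
  exact mul_le_mul_of_nonneg_left
    (twoPointFree_axis_le_of_mul_supNorm_le (criticalBeta_nonneg 3) (by norm_num) hy)
    (Real.rpow_nonneg (Nat.cast_nonneg n) _)

/-- **The critical two-point function of `ℤ³` is not `o(n^{-3/2})` uniformly on balls (plus state =
the tree's `criticalTwoPoint 3`).** `∃ a > 0`, for infinitely many `n`: `a ≤ n^{3/2}⟨σ₀σ_y⟩_{β_c(3)}` for
every `y` with `3‖y‖_∞ ≤ n` (`μ⁺_{β_c} = μ^f_{β_c}` on pairs, `twoPointPlus_criticalBeta_eq_twoPointFree_holds`). [cite: DuminilCopinPanis2025LowerBounds, Theorem 1.3 with the proof of Theorem 1.5 (arXiv:2404.05700 pp. 5–6)] -/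
theorem criticalTwoPoint_ball_frequently_ge :
    ∃ a : ℝ, 0 < a ∧ ∃ᶠ n : ℕ in atTop, ∀ y : Site 3, 3 * Site.supNorm y ≤ n →
      a ≤ (n : ℝ) ^ (3 / 2 : ℝ) * criticalTwoPoint 3 y := by
  obtain ⟨a, ha, h⟩ := twoPointFree_criticalBeta_ball_frequently_ge
  refine ⟨a, ha, h.mono fun n hn y hy => ?_⟩
  unfold criticalTwoPoint
  rw [twoPointPlus_criticalBeta_eq_twoPointFree_holds (d := 3) (by norm_num)]
  exact hn y hy

/-- For `x, y ∈ Λ_L`, `‖y - x‖_∞ ≤ 2L` (private plumbing). [folklore] -/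
private theorem supNorm_sub_le_two_mul_of_mem_box {d L : ℕ} {x y : Site d} (hx : x ∈ box d L)
    (hy : y ∈ box d L) : Site.supNorm (y - x) ≤ 2 * L := by
  rw [← mem_box_iff_supNorm_le, mem_box]
  rw [mem_box] at hx hy
  intro i
  have h1 := hx i
  have h2 := hy i
  simp only [Pi.sub_apply]
  push_cast
  omega

/-- **Block form: the critical block second moment of `ℤ³` is not `o(L^{9/2})`.** There is `a > 0`
with `a·L^{9/2} ≤ Σ_{x,y ∈ Λ_L}⟨σ_xσ_y⟩_{β_c(3)}` for infinitely many `L` (`Λ_L = box 3 L`; the sum is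
`⟨M_L²⟩_{β_c}`, `M_L = Σ_{x∈Λ_L}σ_x`): at a good scale `n` of `criticalTwoPoint_ball_frequently_ge` take
`L = ⌊n/6⌋`, so that every difference `y - x`, `x, y ∈ Λ_L`, has `3‖y-x‖_∞ ≤ 6L ≤ n`, each of the
`(2L+1)⁶ ≥ 64L⁶` terms is `≥ a n^{-3/2} ≥ a (12L)^{-3/2} ≥ a L^{-3/2}/144`. Equivalently the critical block
susceptibility `Σ_L/|Λ_L|` is not `o(L^{3/2})` — "`η ≤ 1/2` along a subsequence" for blocks, with no
existence hypothesis (Duminil-Copin–Panis 2025 print the conditional pointwise Theorem 1.5 only). [cite: DuminilCopinPanis2025LowerBounds, Theorem 1.3 with the proof of Theorem 1.5 (arXiv:2404.05700 pp. 5–6)] [cite: DuminilCopin2019, eq. (4.10), §4.3] -/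
theorem criticalTwoPoint_boxPairSum_frequently_ge :
    ∃ a : ℝ, 0 < a ∧ ∃ᶠ L : ℕ in atTop,
      a * (L : ℝ) ^ (9 / 2 : ℝ) ≤ ∑ p ∈ box 3 L ×ˢ box 3 L, criticalTwoPoint 3 (p.2 - p.1) := by
  obtain ⟨a, ha, h⟩ := criticalTwoPoint_ball_frequently_ge
  refine ⟨a / 3, by positivity, ?_⟩
  rw [Filter.frequently_atTop] at h ⊢
  intro M
  obtain ⟨n, hnM, hn⟩ := h (6 * (M + 1))
  refine ⟨n / 6, ?_, ?_⟩
  · have : M + 1 ≤ n / 6 := by omega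
    omega
  set L : ℕ := n / 6 with hL
  have hL1 : 1 ≤ L := by omega
  have h6L : 6 * L ≤ n := by omega
  have hn12 : n ≤ 12 * L := by omega
  have hLr1 : (1 : ℝ) ≤ L := by exact_mod_cast hL1
  have hLr0 : (0 : ℝ) < L := by positivity
  have hn1 : 1 ≤ n := by omega
  have hnr0 : (0 : ℝ) < n := by exact_mod_cast hn1
  have hnpow : 0 < (n : ℝ) ^ (3 / 2 : ℝ) := Real.rpow_pos_of_pos hnr0 _
  -- every term is at least `a / n^{3/2}`
  have hterm : ∀ p ∈ box 3 L ×ˢ box 3 L, a / (n : ℝ) ^ (3 / 2 : ℝ) ≤ criticalTwoPoint 3 (p.2 - p.1) := by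
    intro p hp
    rw [Finset.mem_product] at hp
    have hsup : 3 * Site.supNorm (p.2 - p.1) ≤ n := by
      have := supNorm_sub_le_two_mul_of_mem_box hp.1 hp.2
      omega
    rw [div_le_iff₀ hnpow, mul_comm]
    exact hn (p.2 - p.1) hsup
  have hcard : (#(box 3 L ×ˢ box 3 L) : ℝ) = (2 * (L : ℝ) + 1) ^ 6 := by
    rw [Finset.card_product, card_box]
    push_cast
    ring
  have hsum : (2 * (L : ℝ) + 1) ^ 6 * (a / (n : ℝ) ^ (3 / 2 : ℝ)) ≤
      ∑ p ∈ box 3 L ×ˢ box 3 L, criticalTwoPoint 3 (p.2 - p.1) := by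
    have h1 := Finset.card_nsmul_le_sum (box 3 L ×ˢ box 3 L)
      (fun p => criticalTwoPoint 3 (p.2 - p.1)) (a / (n : ℝ) ^ (3 / 2 : ℝ)) hterm
    rwa [nsmul_eq_mul, hcard] at h1
  -- `n^{3/2} ≤ (12L)^{3/2} ≤ 144 L^{3/2}` and `L^6 = L^{9/2} L^{3/2}`
  have hn32 : (n : ℝ) ^ (3 / 2 : ℝ) ≤ 144 * (L : ℝ) ^ (3 / 2 : ℝ) := by
    have h1 : (n : ℝ) ≤ 12 * L := by exact_mod_cast hn12
    have h2 : (n : ℝ) ^ (3 / 2 : ℝ) ≤ (12 * (L : ℝ)) ^ (3 / 2 : ℝ) :=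
      Real.rpow_le_rpow (Nat.cast_nonneg n) h1 (by norm_num)
    have h3 : (12 * (L : ℝ)) ^ (3 / 2 : ℝ) = (12 : ℝ) ^ (3 / 2 : ℝ) * (L : ℝ) ^ (3 / 2 : ℝ) :=
      Real.mul_rpow (by norm_num) hLr0.le
    have h4 : (12 : ℝ) ^ (3 / 2 : ℝ) ≤ (12 : ℝ) ^ (2 : ℝ) :=
      Real.rpow_le_rpow_of_exponent_le (by norm_num) (by norm_num)
    have h5 : (12 : ℝ) ^ (2 : ℝ) = 144 := by norm_num
    have h6 : 0 ≤ (L : ℝ) ^ (3 / 2 : ℝ) := Real.rpow_nonneg hLr0.le _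
    calc (n : ℝ) ^ (3 / 2 : ℝ) ≤ (12 : ℝ) ^ (3 / 2 : ℝ) * (L : ℝ) ^ (3 / 2 : ℝ) := h2.trans h3.le
      _ ≤ 144 * (L : ℝ) ^ (3 / 2 : ℝ) := by
          have := mul_le_mul_of_nonneg_right (h4.trans h5.le) h6
          linarith
  have hsplit : (L : ℝ) ^ (9 / 2 : ℝ) * (L : ℝ) ^ (3 / 2 : ℝ) = (L : ℝ) ^ 6 := by
    rw [← Real.rpow_add hLr0]
    norm_num
  have hL32 : 0 < (L : ℝ) ^ (3 / 2 : ℝ) := Real.rpow_pos_of_pos hLr0 _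
  have hL92 : 0 ≤ (L : ℝ) ^ (9 / 2 : ℝ) := Real.rpow_nonneg hLr0.le _
  -- assemble: `a/3 · L^{9/2} ≤ (2L+1)^6 · a / n^{3/2}`
  have hkey : a / 3 * (L : ℝ) ^ (9 / 2 : ℝ) ≤ (2 * (L : ℝ) + 1) ^ 6 * (a / (n : ℝ) ^ (3 / 2 : ℝ)) := by
    rw [mul_div_assoc', le_div_iff₀ hnpow]
    calc a / 3 * (L : ℝ) ^ (9 / 2 : ℝ) * (n : ℝ) ^ (3 / 2 : ℝ)
        ≤ a / 3 * (L : ℝ) ^ (9 / 2 : ℝ) * (144 * (L : ℝ) ^ (3 / 2 : ℝ)) :=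
          mul_le_mul_of_nonneg_left hn32 (by positivity)
      _ = 48 * a * ((L : ℝ) ^ (9 / 2 : ℝ) * (L : ℝ) ^ (3 / 2 : ℝ)) := by ring
      _ = 48 * a * (L : ℝ) ^ 6 := by rw [hsplit]
      _ ≤ 64 * a * (L : ℝ) ^ 6 := by nlinarith [pow_nonneg hLr0.le 6]
      _ = a * (2 * (L : ℝ)) ^ 6 := by ring
      _ ≤ a * (2 * (L : ℝ) + 1) ^ 6 :=
          mul_le_mul_of_nonneg_left (pow_le_pow_left₀ (by positivity) (by linarith) 6) ha.le
      _ = (2 * (L : ℝ) + 1) ^ 6 * a := by ring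
  exact hkey.trans hsum

end Literature.Probability.LatticeModels

end
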